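import Summits.BirchSwinnertonDyer.BirchSwinnertonDyer.Theorems.EdixhovenFibreFiveSevenStarredOptimalManinUnitFiveSevenHcorBlocks
import Literature.NumberTheory.Automorphic.UnboundedDenominatorsInvariantHomPrimePowerPGroup
import HarnessLib

set_option linter.dupNamespace false

/-!
# K★ crux `StarredOptimalManinUnitFiveSeven`, line `cdt_thm1`: the stub `stub_hcor_invariant` for `4 ∤ N`, `27 ∤ N`

The registered stub `CdtThm1.stub_hcor_invariant` (the `SL₂(ℤ)`-invariant form of
[CalegariDimitrovTang2025, Corollary 4.5.3]) was reduced in `HcorBlocks` to the ODD BLOCK CERTIFICATES at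
`p^e`, `e ≥ 3` (plus the `2`-adic levels `4 ∣ N`).  The block certificate at `p^e` for `p ≥ 5`, every `e` and
every finite commutative target of `p`-power exponent is the Literature theorem
`UnboundedDenominators.block_certificate_primePow` (the `p`-primary part of Beyl's theorem
`M(SL₂(ℤ/p^e)) = 0`, [Beyl1986], proved in the tree by an explicit descent along central extensions of
`SL₂(ℤ/p^e)`, files `SL2PrimePow*`).  Feeding it into the `HcorBlocks` reduction — whose certificates are
only ever requested at primes `ℓ` with `ℓ^e ∣ N`, `e ≥ 3` — gives:

* `cor453_invariant_form_of_not_four_dvd_of_not_27_dvd`: **for every `N ≠ 0` with `4 ∤ N` and `27 ∤ N`,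
  every finite commutative `Q` and every `SL₂(ℤ)`-invariant `θ : Γ(N) → Q`, `θ` kills `Γ(12N)`**;
* `stub_hcor_invariant_of_not_four_dvd_of_not_27_dvd`: the same in the exact shape of the stub (`∃ M ≠ 0`).

So the residue of `stub_hcor_invariant` is now `{N : 4 ∣ N} ∪ {N : 27 ∣ N}` — precisely the `2`-part of the
Schur multiplier of `SL₂(ℤ/2^e)`, `e ≥ 2` (which is `ℤ/2`, killed in `SL₂(ℤ)` by the relation `(ST)³ = S²`,
[Beyl1986]) and the `3`-part at `3^e`, `e ≥ 3`, for targets of exponent `≥ 9`.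
K★ / the Manin-constant statement / BSD are NOT proved by this file.
-/

open scoped MatrixGroups commutatorElement

universe u

namespace Summit.BirchSwinnertonDyer.BirchSwinnertonDyer.Theorems

namespace HcorOddDepth

open CongruenceSubgroup Matrix.SpecialLinearGroup ModularGroup
open Literature.NumberTheory.Automorphic.UnboundedDenominators

/-- **The invariant form of CDT Cor. 4.5.3 for `4 ∤ N`, `27 ∤ N`.**  For every `N ≠ 0` with `4 ∤ N` and
`27 ∤ N`, every finite commutative `Q` and every `SL₂(ℤ)`-conjugation-invariant `θ : Γ(N) → Q`, `θ` is trivial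
on `Γ(12N)`.  Proof: the `HcorBlocks` corestriction-to-`ℓ`-torsion argument, with the block certificates at
`ℓ^e` (`e ≥ 3`, `ℓ^e ∣ N`, hence `ℓ ≥ 5`) supplied by `block_certificate_primePow`.
[cite: CalegariDimitrovTang2025, Corollary 4.5.3] [cite: Beyl1986, Theorem] -/
theorem cor453_invariant_form_of_not_four_dvd_of_not_27_dvd {N : ℕ} (hN0 : N ≠ 0) (h4 : ¬ 4 ∣ N)
    (h27 : ¬ 27 ∣ N) (Q : Type u) [CommGroup Q] [Finite Q] (θ : Gamma N →* Q)
    (hθ : ∀ (g x : SL(2, ℤ)) (hx : x ∈ Gamma N) (hgx : g * x * g⁻¹ ∈ Gamma N),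
      θ ⟨g * x * g⁻¹, hgx⟩ = θ ⟨x, hx⟩) :
    ∀ (x : SL(2, ℤ)) (hx : x ∈ Gamma N), x ∈ Gamma (12 * N) → θ ⟨x, hx⟩ = 1 := by
  intro x hx hx12
  set n : ℕ := Nat.card Q with hn
  have hn0 : n ≠ 0 := Nat.card_pos.ne'
  by_contra hne
  have hord : orderOf (θ ⟨x, hx⟩) ≠ 1 := fun h1 ↦ hne (orderOf_eq_one_iff.mp h1)
  obtain ⟨ℓ, hℓ, hℓq⟩ := Nat.exists_prime_and_dvd hord
  have hℓn : ℓ ∣ n := hℓq.trans (orderOf_dvd_of_pow_eq_one (hn ▸ pow_card_eq_one'))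
  -- corestriction to the `ℓ`-power torsion
  set m : ℕ := ordCompl[ℓ] n with hm_def
  have hnm : ordProj[ℓ] n * m = n := Nat.ordProj_mul_ordCompl_eq_self n ℓ
  have hpow : ∀ (y : Gamma N), ((powMonoidHom m).comp θ) y = θ y ^ m := fun y ↦ rfl
  have he : ∀ y : Gamma N, ((powMonoidHom m).comp θ) y ^ (ℓ ^ n.factorization ℓ) = 1 := by
    intro y
    rw [hpow, ← pow_mul, mul_comm, hnm, hn]
    exact pow_card_eq_one'
  set T : Subgroup Q := (powMonoidHom (ℓ ^ n.factorization ℓ) : Q →* Q).ker with hT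
  set θT : Gamma N →* T := ((powMonoidHom m).comp θ).codRestrict T
    (fun y ↦ by rw [hT, MonoidHom.mem_ker, powMonoidHom_apply]; exact he y) with hθT
  have hθTval : ∀ y : Gamma N, ((θT y : T) : Q) = θ y ^ m := fun y ↦ rfl
  have hQT : ∀ q : T, q ^ (ℓ ^ n.factorization ℓ) = 1 := by
    intro q
    apply Subtype.ext
    have hq : (q : Q) ∈ (powMonoidHom (ℓ ^ n.factorization ℓ) : Q →* Q).ker := q.2
    rw [MonoidHom.mem_ker, powMonoidHom_apply] at hq
    rw [Subgroup.coe_pow, Subgroup.coe_one]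
    exact hq
  have hθTinv : ∀ (g y : SL(2, ℤ)) (hy : y ∈ Gamma N) (hgy : g * y * g⁻¹ ∈ Gamma N),
      θT ⟨g * y * g⁻¹, hgy⟩ = θT ⟨y, hy⟩ := by
    intro g y hy hgy
    apply Subtype.ext
    rw [hθTval, hθTval, hθ g y hy hgy]
  have key : θ ⟨x, hx⟩ ^ m = 1 := by
    have hcertT : ∀ (e m' : ℕ), 3 ≤ e → ℓ ^ e ∣ N → m' ≠ 0 → m'.Coprime ℓ →
        ∀ (ψ : Gamma (m' * ℓ ^ e) →* T),
        (∀ (g x : SL(2, ℤ)) (hx : x ∈ Gamma (m' * ℓ ^ e)) (hgx : g * x * g⁻¹ ∈ Gamma (m' * ℓ ^ e)),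
          ψ ⟨g * x * g⁻¹, hgx⟩ = ψ ⟨x, hx⟩) →
        ∀ (y : SL(2, ℤ)) (hy : y ∈ Gamma (m' * ℓ ^ e)),
          y ∈ ⁅Gamma m', Gamma m'⁆ ⊔ ψ.ker.map (Gamma (m' * ℓ ^ e)).subtype → ψ ⟨y, hy⟩ = 1 := by
      intro e m' he3 hdvd _hm'0 hm'ℓ ψ hψ
      have hℓ2 : ℓ ≠ 2 := by
        rintro rfl
        exact h4 (dvd_trans (pow_dvd_pow 2 (by omega : 2 ≤ e)) hdvd)
      have hℓ3 : ℓ ≠ 3 := by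
        rintro rfl
        exact h27 (dvd_trans (by norm_num : (27 : ℕ) ∣ 3 ^ 3) ((pow_dvd_pow 3 he3).trans hdvd))
      have hℓ5 : 5 ≤ ℓ := by
        have h2 := hℓ.two_le
        by_contra h
        have h4' : ℓ = 4 := by omega
        exact absurd (h4' ▸ hℓ : (4 : ℕ).Prime) (by norm_num)
      haveI : Fact ℓ.Prime := ⟨hℓ⟩
      exact block_certificate_primePow hℓ5 hm'ℓ T hQT ψ hψ
    have h1 := HcorBlocks.cor453_invariant_form_of_block_certificates_exponent hℓ T hQT hN0 (fun _ ↦ h4)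
      hcertT θT hθTinv x hx hx12
    have h2 := congrArg Subtype.val h1
    rw [hθTval, Subgroup.coe_one] at h2
    exact h2
  have h1 : ℓ ∣ ordCompl[ℓ] n := hℓq.trans (orderOf_dvd_of_pow_eq_one key)
  exact hℓ.one_lt.ne' (Nat.Coprime.eq_one_of_dvd (Nat.coprime_ordCompl hℓ hn0) h1)

/-- **The stub `CdtThm1.stub_hcor_invariant` for all levels `N` with `4 ∤ N` and `27 ∤ N`**, in the stub's
exact shape: an `SL₂(ℤ)`-invariant homomorphism `θ : Γ(N) → Q` to a finite commutative group kills some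
`Γ(M)`, `M ≠ 0` (namely `M = 12N`; `N ≠ 0` is forced by `4 ∤ N`).
[cite: CalegariDimitrovTang2025, Corollary 4.5.3] [cite: Beyl1986, Theorem] -/
theorem stub_hcor_invariant_of_not_four_dvd_of_not_27_dvd (N : ℕ) (h4 : ¬ 4 ∣ N) (h27 : ¬ 27 ∣ N)
    (Q : Type u) [CommGroup Q] [Finite Q] (θ : Gamma N →* Q)
    (hθ : ∀ (g x : SL(2, ℤ)) (hx : x ∈ Gamma N) (hgx : g * x * g⁻¹ ∈ Gamma N),
      θ ⟨g * x * g⁻¹, hgx⟩ = θ ⟨x, hx⟩) :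
    ∃ M : ℕ, M ≠ 0 ∧ ∀ (x : SL(2, ℤ)) (hx : x ∈ Gamma N), x ∈ Gamma M → θ ⟨x, hx⟩ = 1 := by
  have hN0 : N ≠ 0 := by
    rintro rfl
    exact h4 (dvd_zero 4)
  exact ⟨12 * N, Nat.mul_ne_zero (by norm_num) hN0,
    cor453_invariant_form_of_not_four_dvd_of_not_27_dvd hN0 h4 h27 Q θ hθ⟩

end HcorOddDepth

end Summit.BirchSwinnertonDyer.BirchSwinnertonDyer.Theorems
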